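import Literature.NumberTheory.EllipticCurves.SkinnerUrban2014.PAdicUnitPeriodRatioProofs
import Literature.NumberTheory.EllipticCurves.Kobayashi2003.SignedKatoDivisibility
import Literature.NumberTheory.EllipticCurves.Kobayashi2003.SignedSelmerTorsion
import Literature.NumberTheory.EllipticCurves.Kobayashi2003.SignedColemanKatoZeta
import Literature.NumberTheory.EllipticCurves.BurungaleCastellaSkinner2025.GreenbergMuInvariantGoodReduction
import HarnessLib

set_option linter.dupNamespace false -- `…BirchSwinnertonDyer.BirchSwinnertonDyer…` is the cell's nested layout (D-0017)
set_option autoImplicit false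

/-!
# Crux 19002 `KobayashiMainConjectureSmallImage` (routes `SignedLowerHalves` rank 4 / `SignedBaseChange`), skeleton of record
# `birth_acns` v6 `Cruxes/KobayashiMainConjectureSmallImage/Lines/birth_acns.lean` (sha16 43169bd7640f21ff, 2026-08-28T13:32:52Z):
# `stub_publishedInputs_ns` — SEVEN named facts — from FIVE printed inputs and Mazur 1978 Cor. 4.1
# (LADDER-BSD D-0154 (2) INPUTS, desk `pub/bsd-wall/bsd-inputs`, INPUTS-LIST-2 rows SLH/SBC; tranche entry T23 of ADDENDUM-17 §Z)

`--supports stmt-BirchSwinnertonDyer-19002` (helper mode).  Conjuncts 3 and 4 of v6's `stub_publishedInputs_ns`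
(`realPeriodRat_eq_unit_mul_plusPeriod`, INPUTS-LIST-2 F5: the period unit `Ω_E ∕ Ω_E⁺` at a good prime `p ≥ 5`, `E[p]` irreducible;
`realPeriodRat_eq_unit_mul_plusPeriod_three`, F6: the same at the good prime `3`) are THEOREMS of the tree GIVEN Mazur 1978 Cor. 4.1
(`ModularForms.mazur_not_dvd_maninConstant_of_odd`, INPUTS-LIST-2 F7), by
`Literature.NumberTheory.EllipticCurves.SkinnerUrban2014.realPeriodRat_eq_unit_mul_plusPeriod_of_mazur` (PAdicUnitPeriodRatioProofs.lean:577) and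
`…realPeriodRat_eq_unit_mul_plusPeriod_three_of_mazur` (ibid.:586).  After this file the displayed published inputs of `stub_publishedInputs_ns`
are 5 + 1 = 6 distinct named facts (was 7: F5 and F6 are no longer load-bearing once F7 is granted; F7 is already displayed by the X6 / X9 / X10b /
ISB / X11a lines, so the portfolio's distinct-input count does not grow).  The lead (bsd-line-slh-p3) may re-cut `stub_publishedInputs_ns` to the
five conjuncts + Mazur in v7 and feed `KobayashiMainConjectureSmallImage_of` through `publishedInputs_ns_of_five_of_mazur`.

Honest framing: CONDITIONAL on the five prints and on Mazur Cor. 4.1 as typed; pure glue; closes nothing by itself; no crux of substance and no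
summit statement is proved; the Birch–Swinnerton-Dyer conjecture is NOT proved by any of this.
References: [Mazur1978] Cor. 4.1; [GreenbergVatsal2000] §3 Remark (3.4); [Kobayashi2003] Thms. 1.2, 4.1, 6.2, 6.3, 7.3; [BreuilConradDiamondTaylor2001]
Thm. A; [BurungaleCastellaSkinner2025] Prop. 4.2.2.
-/

namespace Summit.BirchSwinnertonDyer.BirchSwinnertonDyer.Theorems.SignedLowerHalves.InputsPublishedNs

open Literature.NumberTheory.EllipticCurves Literature.NumberTheory.EllipticCurves.ModularForms
  Literature.NumberTheory.EllipticCurves.SkinnerUrban2014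

/-- **v6's `stub_publishedInputs_ns` (seven conjuncts, VERBATIM) ⟸ FIVE published inputs (Kobayashi Thm. 4.1 · Kobayashi Thm. 1.2 ·
Kobayashi Thms. 6.2/6.3/7.3 i) Coleman–Kato ζ construction fact · BCDT modular parametrisation · BCS 2025 Prop. 4.2.2) and Mazur Cor. 4.1.**
CONDITIONAL; closes nothing; BSD is not proved.
[cite: Mazur1978, Cor. 4.1] [cite: Kobayashi2003, Thm. 1.2, Thm. 4.1, Thm. 6.2, Thm. 6.3, Thm. 7.3 i)] [cite: BurungaleCastellaSkinner2025, Prop. 4.2.2] -/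
theorem publishedInputs_ns_of_five_of_mazur
    (h : Kobayashi2003.thm41_signedCharIdeal_divisibility ∧ Kobayashi2003.thm12_signedSelmerDual_finite_torsion ∧
      Kobayashi2003.thm62_63_73_signedColemanKato_zeta ∧ ModularForms.nonempty_modularParametrizationData ∧
      BurungaleCastellaSkinner2025.prop422_greenbergAnyRoot_hasUnitContent_minus)
    (hM : mazur_not_dvd_maninConstant_of_odd) :
    Literature.NumberTheory.EllipticCurves.Kobayashi2003.thm41_signedCharIdeal_divisibility ∧
    Literature.NumberTheory.EllipticCurves.Kobayashi2003.thm12_signedSelmerDual_finite_torsion ∧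
    Literature.NumberTheory.EllipticCurves.realPeriodRat_eq_unit_mul_plusPeriod ∧
    Literature.NumberTheory.EllipticCurves.realPeriodRat_eq_unit_mul_plusPeriod_three ∧
    Literature.NumberTheory.EllipticCurves.Kobayashi2003.thm62_63_73_signedColemanKato_zeta ∧
    Literature.NumberTheory.EllipticCurves.ModularForms.nonempty_modularParametrizationData ∧
    Literature.NumberTheory.EllipticCurves.BurungaleCastellaSkinner2025.prop422_greenbergAnyRoot_hasUnitContent_minus :=
  ⟨h.1, h.2.1, realPeriodRat_eq_unit_mul_plusPeriod_of_mazur hM, realPeriodRat_eq_unit_mul_plusPeriod_three_of_mazur hM,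
    h.2.2.1, h.2.2.2.1, h.2.2.2.2⟩

/-- The period-unit pair alone (F5 ∧ F6) from Mazur Cor. 4.1 — the two conjuncts this file removes from the display, for a lead who
prefers to keep the seven-conjunct stub and feed conjuncts 3–4 separately.  [cite: Mazur1978, Cor. 4.1] [cite: GreenbergVatsal2000, §3, Remark 3.4] -/
theorem periodUnits_of_mazur (hM : mazur_not_dvd_maninConstant_of_odd) :
    Literature.NumberTheory.EllipticCurves.realPeriodRat_eq_unit_mul_plusPeriod ∧
    Literature.NumberTheory.EllipticCurves.realPeriodRat_eq_unit_mul_plusPeriod_three :=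
  ⟨realPeriodRat_eq_unit_mul_plusPeriod_of_mazur hM, realPeriodRat_eq_unit_mul_plusPeriod_three_of_mazur hM⟩

end Summit.BirchSwinnertonDyer.BirchSwinnertonDyer.Theorems.SignedLowerHalves.InputsPublishedNs
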